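import Mathlib
import Literature.Analysis.UnboundedOperators.ConjugateOperatorRegularity
import HarnessLib
import Summits.AtomisticToContinuum.FouriersLaw.Theorems.EmbeddedDrudeMourreMourreDissolutionLAPGronwall
import Summits.AtomisticToContinuum.FouriersLaw.Theorems.EmbeddedDrudeMourreMourreDissolutionLAPDissipativeResolventDeriv

/-!
# Stub `stub_mourreThresholdLAP` — F4 (part 1/2): Gronwall integration of Mourre's differential inequality

Item `stmt-AtomisticToContinuum-12594` (crux `MourreDissolution` of route `EmbeddedDrudeMourre`,
sub-problem `FouriersLaw`), line `separable-vertex-faddeev-pair-sector`, stub S6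
`stub_mourreThresholdLAP` (Mourre's limiting absorption principle, `C²` form), helper F4 of the
proof map (Mourre 1981; ABG = Amrein–Boutet de Monvel–Georgescu 1996, proof of Thm. 7.3.1,
eqs. (7.3.10)–(7.3.12)), part 1/2: the two pieces of F4 that do not depend on the commutator
expansion — the GRONWALL STEP and the REAL-VARIABLE BOOKKEEPING of the constants. Part 2/2
(`…LAPDerivativeBound`) instantiates them with the plateau cutoff and the error decomposition.

Setting (notation of `…LAPDissipativeResolvent{,Identities,Deriv}`, `…LAPUniformCauchy`):
`G_ε(z) = mourreG U M ε z` for a dissipative bounded `M`, `Im z < 0`, `F_ε = ⟪f, G_ε(z) f⟫`,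
`d/dε F_ε = -i ⟪f, G_ε M G_ε f⟫`.

* §1 `∫_{(0, ε₀]} (√τ)⁻¹ dτ = 2√ε₀` (the integrable singularity of Mourre's method);
* §2 THE GRONWALL STEP: a differential inequality
  `‖⟪f, G_ε M G_ε f⟫‖ ≤ η₀ + c₁ (√ε)⁻¹ √‖F_ε‖ + ψ₀ ‖F_ε‖` on `(0, ε₀)` and `‖F_{ε₀}‖ ≤ B` give
  `‖F_ε‖ ≤ C₁ = 2 (B + ε₀η₀ + (2c₁√ε₀)²) e^{ε₀ψ₀}` on `(0, ε₀]` (`norm_le_sqrt_gronwall_uniform` of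
  `…LAPGronwall`), hence the INTEGRABLE DERIVATIVE BOUND
  `‖⟪f, G_ε M G_ε f⟫‖ ≤ κ(ε) = η₀ + c₁ √C₁ (√ε)⁻¹ + ψ₀ C₁`;
* §3 THE BOOKKEEPING LEMMA: the shape delivered by the commutator expansion,
  `α(X + Y) + ε m₁ Y X + c₀ (β(n + εmY)(n + (εm + b)X) + β(n + (εm + b)Y)(n + εmX))`
  (`X = ‖G f‖`, `Y = ‖G† f‖`, no product `XY` without a factor `ε`), fed with the quadratic
  estimates `X, Y ≤ (2/(aε))^{1/2} ‖F‖^{1/2} + (2/δ')‖f‖`, is `≤ η₀ + c₁ (√ε)⁻¹ √‖F‖ + ψ₀ ‖F‖`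
  with constants depending only on `(α, m, m₁, c₀', β, n, a, δ')` — uniformly in `c₀ ≤ c₀'`,
  `b ≤ 1`, `ε ≤ 1` (headline `mourre_differential_inequality_bookkeeping`).
-/

noncomputable section

open MeasureTheory Complex Filter Topology Set intervalIntegral
open scoped InnerProductSpace ComplexConjugate ENNReal NNReal

namespace Summit.AtomisticToContinuum.FouriersLaw.Theorems.MourreDissolution

open Literature.Analysis.UnboundedOperators
open Literature.Analysis.UnboundedOperators.UnitaryRep

variable {H : Type*} [NormedAddCommGroup H] [InnerProductSpace ℂ H] [CompleteSpace H]

/-! ## §1. The integrable singularity `(√τ)⁻¹` -/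

/-- `d/dτ (2√τ) = (√τ)⁻¹` for `τ > 0`. [folklore] -/
theorem hasDerivAt_two_mul_sqrt {τ : ℝ} (hτ : 0 < τ) :
    HasDerivAt (fun τ : ℝ => 2 * Real.sqrt τ) ((Real.sqrt τ)⁻¹) τ := by
  have h := (Real.hasDerivAt_sqrt hτ.ne').const_mul 2
  have e : (2 : ℝ) * (1 / (2 * Real.sqrt τ)) = (Real.sqrt τ)⁻¹ := by
    rw [one_div, mul_inv, ← mul_assoc, mul_inv_cancel₀ (two_ne_zero : (2 : ℝ) ≠ 0), one_mul]
  rwa [e] at h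

/-- `(√τ)⁻¹` is integrable on `(0, ε₀]` (a nonnegative derivative of the continuous `2√τ`).
[folklore] -/
theorem integrableOn_inv_sqrt (ε₀ : ℝ) :
    IntegrableOn (fun τ : ℝ => (Real.sqrt τ)⁻¹) (Set.Ioc 0 ε₀) := by
  rcases le_or_gt ε₀ 0 with h | h
  · rw [Set.Ioc_eq_empty (not_lt.2 h)]
    exact integrableOn_empty
  · exact intervalIntegral.integrableOn_deriv_of_nonneg
      (continuous_const.mul Real.continuous_sqrt).continuousOn
      (fun τ hτ => hasDerivAt_two_mul_sqrt hτ.1) (fun τ _ => inv_nonneg.2 (Real.sqrt_nonneg τ))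

/-- `∫_{(0, ε₀]} (√τ)⁻¹ dτ = 2√ε₀`. [folklore] -/
theorem integral_inv_sqrt {ε₀ : ℝ} (hε₀ : 0 ≤ ε₀) :
    ∫ τ in Set.Ioc 0 ε₀, (Real.sqrt τ)⁻¹ = 2 * Real.sqrt ε₀ := by
  rw [← intervalIntegral.integral_of_le hε₀,
    intervalIntegral.integral_eq_sub_of_hasDerivAt_of_le hε₀
      (continuous_const.mul Real.continuous_sqrt).continuousOn
      (fun τ hτ => hasDerivAt_two_mul_sqrt hτ.1)
      ((intervalIntegrable_iff_integrableOn_Ioc_of_le hε₀).2 (integrableOn_inv_sqrt ε₀))]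
  simp

/-! ## §2. The Gronwall step -/

/-- **Gronwall integration of Mourre's differential inequality** (ABG (7.3.11)–(7.3.12)): for
dissipative `M`, `Im z < 0`, `ε₀ > 0` and nonnegative constants `η₀, c₁, ψ₀`, if
`‖⟪f, G_ε M G_ε f⟫‖ ≤ η₀ + c₁ (√ε)⁻¹ √‖F_ε‖ + ψ₀ ‖F_ε‖` for `ε ∈ (0, ε₀)` (`F_ε = ⟪f, G_ε(z) f⟫`)
and `‖F_{ε₀}‖ ≤ B`, then `‖F_ε‖ ≤ 2 (B + ε₀ η₀ + (2 c₁ √ε₀)²) e^{ε₀ ψ₀}` for all `ε ∈ (0, ε₀]`.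
[cite: AmreinBoutetdeMonvelGeorgescu1996, Thm. 7.3.1 eqs. (7.3.11)–(7.3.12)] -/
theorem norm_inner_mourreG_le_of_differential_inequality {M : H →L[ℂ] H}
    (hM : ∀ f : H, 0 ≤ (⟪f, M f⟫_ℂ).re) {z : ℂ} (hz : z.im < 0) (U : OneParameterUnitaryGroup H)
    (f : H) {ε₀ η₀ c₁ ψ₀ B : ℝ} (hε₀ : 0 < ε₀) (hη₀ : 0 ≤ η₀) (hc₁ : 0 ≤ c₁) (hψ₀ : 0 ≤ ψ₀)
    (hB : ‖⟪f, mourreG U M ε₀ z f⟫_ℂ‖ ≤ B)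
    (hDI : ∀ ε ∈ Set.Ioo 0 ε₀, ‖⟪f, mourreG U M ε z (M (mourreG U M ε z f))⟫_ℂ‖ ≤
      η₀ + c₁ * (Real.sqrt ε)⁻¹ * Real.sqrt ‖⟪f, mourreG U M ε z f⟫_ℂ‖ +
        ψ₀ * ‖⟪f, mourreG U M ε z f⟫_ℂ‖) :
    ∀ ε ∈ Set.Ioc 0 ε₀, ‖⟪f, mourreG U M ε z f⟫_ℂ‖ ≤
      2 * (B + ε₀ * η₀ + (c₁ * (2 * Real.sqrt ε₀)) ^ 2) * Real.exp (ε₀ * ψ₀) := by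
  set F : ℝ → ℂ := fun ε => ⟪f, mourreG U M ε z f⟫_ℂ with hF
  set F' : ℝ → ℂ := fun ε => -(I : ℂ) * ⟪f, mourreG U M ε z (M (mourreG U M ε z f))⟫_ℂ with hF'
  have hFc : ContinuousOn F (Set.Ioc 0 ε₀) :=
    (continuousOn_const.inner
      ((continuousOn_mourreG_Ici hM hz U).clm_apply continuousOn_const)).mono
      fun ε hε => Set.mem_Ici.2 hε.1.le
  have hFd : ∀ ε ∈ Set.Ioo 0 ε₀, HasDerivAt F (F' ε) ε := fun ε hε =>
    hasDerivAt_inner_mourreG hM hz.ne (mul_neg_of_pos_of_neg hε.1 hz) U f f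
  have hη : IntegrableOn (fun _ : ℝ => η₀) (Set.Ioc 0 ε₀) :=
    integrableOn_const (hs := measure_Ioc_lt_top.ne)
  have hφ : IntegrableOn (fun τ : ℝ => c₁ * (Real.sqrt τ)⁻¹) (Set.Ioc 0 ε₀) :=
    (integrableOn_inv_sqrt ε₀).const_mul c₁
  have hψ : IntegrableOn (fun _ : ℝ => ψ₀) (Set.Ioc 0 ε₀) :=
    integrableOn_const (hs := measure_Ioc_lt_top.ne)
  have hbound : ∀ ε ∈ Set.Ioo 0 ε₀,
      ‖F' ε‖ ≤ η₀ + c₁ * (Real.sqrt ε)⁻¹ * Real.sqrt ‖F ε‖ + ψ₀ * ‖F ε‖ := by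
    intro ε hε
    have e : ‖F' ε‖ = ‖⟪f, mourreG U M ε z (M (mourreG U M ε z f))⟫_ℂ‖ := by
      simp only [hF', norm_mul, norm_neg, Complex.norm_I, one_mul]
    rw [e]
    exact hDI ε hε
  have key := norm_le_sqrt_gronwall_uniform F F' (fun _ => η₀) (fun τ => c₁ * (Real.sqrt τ)⁻¹)
    (fun _ => ψ₀) ε₀ hFc hFd hη hφ hψ (fun _ _ => hη₀) (fun ε _ => by positivity)
    (fun _ _ => hψ₀) hbound
  have i1 : ∫ _ in Set.Ioc 0 ε₀, η₀ = ε₀ * η₀ := by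
    rw [setIntegral_const, Real.volume_real_Ioc_of_le hε₀.le, sub_zero, smul_eq_mul]
  have i2 : ∫ τ in Set.Ioc 0 ε₀, c₁ * (Real.sqrt τ)⁻¹ = c₁ * (2 * Real.sqrt ε₀) := by
    rw [MeasureTheory.integral_const_mul, integral_inv_sqrt hε₀.le]
  have i3 : ∫ _ in Set.Ioc 0 ε₀, ψ₀ = ε₀ * ψ₀ := by
    rw [setIntegral_const, Real.volume_real_Ioc_of_le hε₀.le, sub_zero, smul_eq_mul]
  intro ε hε
  have h := key ε hε
  rw [i1, i2, i3] at h
  refine h.trans ?_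
  gcongr

/-- **The integrable derivative bound** (ABG (7.3.12)): under the hypotheses of
`norm_inner_mourreG_le_of_differential_inequality`, with
`C₁ = 2 (B + ε₀ η₀ + (2 c₁ √ε₀)²) e^{ε₀ ψ₀}`, for every `ε ∈ (0, ε₀)`:
`‖⟪f, G_ε M G_ε f⟫‖ ≤ η₀ + c₁ √C₁ (√ε)⁻¹ + ψ₀ C₁`.
[cite: AmreinBoutetdeMonvelGeorgescu1996, Thm. 7.3.1 eq. (7.3.12)] -/
theorem norm_inner_mourreG_mul_mul_le_of_differential_inequality {M : H →L[ℂ] H}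
    (hM : ∀ f : H, 0 ≤ (⟪f, M f⟫_ℂ).re) {z : ℂ} (hz : z.im < 0) (U : OneParameterUnitaryGroup H)
    (f : H) {ε₀ η₀ c₁ ψ₀ B : ℝ} (hε₀ : 0 < ε₀) (hη₀ : 0 ≤ η₀) (hc₁ : 0 ≤ c₁) (hψ₀ : 0 ≤ ψ₀)
    (hB : ‖⟪f, mourreG U M ε₀ z f⟫_ℂ‖ ≤ B)
    (hDI : ∀ ε ∈ Set.Ioo 0 ε₀, ‖⟪f, mourreG U M ε z (M (mourreG U M ε z f))⟫_ℂ‖ ≤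
      η₀ + c₁ * (Real.sqrt ε)⁻¹ * Real.sqrt ‖⟪f, mourreG U M ε z f⟫_ℂ‖ +
        ψ₀ * ‖⟪f, mourreG U M ε z f⟫_ℂ‖) :
    ∀ ε ∈ Set.Ioo 0 ε₀, ‖⟪f, mourreG U M ε z (M (mourreG U M ε z f))⟫_ℂ‖ ≤
      η₀ + c₁ * Real.sqrt (2 * (B + ε₀ * η₀ + (c₁ * (2 * Real.sqrt ε₀)) ^ 2) * Real.exp (ε₀ * ψ₀)) *
          (Real.sqrt ε)⁻¹ +
        ψ₀ * (2 * (B + ε₀ * η₀ + (c₁ * (2 * Real.sqrt ε₀)) ^ 2) * Real.exp (ε₀ * ψ₀)) := by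
  intro ε hε
  have h1 := norm_inner_mourreG_le_of_differential_inequality hM hz U f hε₀ hη₀ hc₁ hψ₀ hB hDI ε
    ⟨hε.1, hε.2.le⟩
  calc ‖⟪f, mourreG U M ε z (M (mourreG U M ε z f))⟫_ℂ‖
      ≤ η₀ + c₁ * (Real.sqrt ε)⁻¹ * Real.sqrt ‖⟪f, mourreG U M ε z f⟫_ℂ‖ +
          ψ₀ * ‖⟪f, mourreG U M ε z f⟫_ℂ‖ := hDI ε hε
    _ ≤ η₀ + c₁ * (Real.sqrt ε)⁻¹ *
          Real.sqrt (2 * (B + ε₀ * η₀ + (c₁ * (2 * Real.sqrt ε₀)) ^ 2) * Real.exp (ε₀ * ψ₀)) +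
          ψ₀ * (2 * (B + ε₀ * η₀ + (c₁ * (2 * Real.sqrt ε₀)) ^ 2) * Real.exp (ε₀ * ψ₀)) := by
        gcongr
    _ = _ := by ring

/-- The derivative bound `κ(ε) = k₀ + k₁ (√ε)⁻¹ + k₂` is integrable on `(0, ε₀]`. [folklore] -/
theorem integrableOn_const_add_mul_inv_sqrt (k₀ k₁ k₂ ε₀ : ℝ) :
    IntegrableOn (fun ε : ℝ => k₀ + k₁ * (Real.sqrt ε)⁻¹ + k₂) (Set.Ioc 0 ε₀) :=
  ((integrableOn_const (C := k₀) (hs := measure_Ioc_lt_top.ne)).add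
    ((integrableOn_inv_sqrt ε₀).const_mul k₁)).add
    (integrableOn_const (C := k₂) (hs := measure_Ioc_lt_top.ne))

/-! ## §3. The bookkeeping lemma -/

/-- Expansion bound behind the bookkeeping lemma: for `0 ≤ ε ≤ 1`, `0 ≤ b ≤ 1` and nonnegative
`n, m, w`, `(n + εmw)(n + (εm + b)w) ≤ n² + n(2m + 1)w + m(m + 1) εw²`. [folklore] -/
theorem mourre_bookkeeping_poly {n m w ε b : ℝ} (hn : 0 ≤ n) (hm : 0 ≤ m) (hw : 0 ≤ w)
    (hε : 0 ≤ ε) (hε1 : ε ≤ 1) (hb1 : b ≤ 1) :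
    (n + ε * m * w) * (n + (ε * m + b) * w) ≤
      n ^ 2 + n * (2 * m + 1) * w + m * (m + 1) * (ε * w ^ 2) := by
  have hεm : ε * m ≤ m := mul_le_of_le_one_left hm hε1
  have hεmb : ε * m + b ≤ m + 1 := add_le_add hεm hb1
  have e : (n + ε * m * w) * (n + (ε * m + b) * w) =
      n ^ 2 + n * (ε * m + b) * w + ε * (m * w * n) + ε * m * (ε * m + b) * w ^ 2 := by ring
  have q1 : n * (ε * m + b) * w ≤ n * (m + 1) * w := by gcongr
  have q2 : ε * (m * w * n) ≤ m * w * n := mul_le_of_le_one_left (by positivity) hε1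
  have q3 : ε * m * (ε * m + b) * w ^ 2 ≤ ε * m * (m + 1) * w ^ 2 := by gcongr
  rw [e]
  linarith only [q1, q2, q3]

/-- **The bookkeeping lemma of Mourre's differential inequality** (ABG (7.3.10)–(7.3.11)): for
nonnegative parameters `α, m, m₁, c₀', β, n` and `a, δ' > 0` there are nonnegative constants
`η₀, c₁, ψ₀` such that, for all `0 ≤ c₀ ≤ c₀'`, `0 ≤ b ≤ 1`, `0 < ε ≤ 1` and nonnegative
`X, Y, Φ` with the quadratic estimates `X, Y ≤ (2/(aε))^{1/2} Φ^{1/2} + (2/δ') n`,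
`α(X + Y) + ε m₁ Y X + c₀ (β (n + εmY)(n + (εm + b)X) + β (n + (εm + b)Y)(n + εmX))
  ≤ η₀ + c₁ (√ε)⁻¹ √Φ + ψ₀ Φ`.
(In the application `X = ‖G_ε f‖`, `Y = ‖G_ε† f‖`, `Φ = ‖⟪f, G_ε f⟫‖`, `α = ‖A f‖`, `m = ‖M‖`,
`m₁ = ‖[M, iA]‖`, `c₀ = ‖[R(z₀), iA]‖`, `β = 1 + 1/δ'`, `b = |z - z₀|`, `n = ‖f‖`.)
[cite: AmreinBoutetdeMonvelGeorgescu1996, Thm. 7.3.1 eqs. (7.3.10)–(7.3.11)] -/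
theorem exists_mourre_bookkeeping_constants {α m m₁ c₀' β n a δ' : ℝ} (hα : 0 ≤ α)
    (hm : 0 ≤ m) (hm₁ : 0 ≤ m₁) (hc₀' : 0 ≤ c₀') (hβ : 0 ≤ β) (hn : 0 ≤ n) (ha : 0 < a)
    (hδ : 0 < δ') :
    ∃ η₀ c₁ ψ₀ : ℝ, 0 ≤ η₀ ∧ 0 ≤ c₁ ∧ 0 ≤ ψ₀ ∧
      ∀ (c₀ b ε X Y Φ : ℝ), 0 ≤ c₀ → c₀ ≤ c₀' → 0 ≤ b → b ≤ 1 → 0 < ε → ε ≤ 1 →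
        0 ≤ X → 0 ≤ Y → 0 ≤ Φ →
        X ≤ Real.sqrt (2 * (a * ε)⁻¹) * Real.sqrt Φ + 2 * δ'⁻¹ * n →
        Y ≤ Real.sqrt (2 * (a * ε)⁻¹) * Real.sqrt Φ + 2 * δ'⁻¹ * n →
        α * (X + Y) + ε * m₁ * Y * X +
            c₀ * (β * (n + ε * m * Y) * (n + (ε * m + b) * X) +
              β * (n + (ε * m + b) * Y) * (n + ε * m * X)) ≤
          η₀ + c₁ * (Real.sqrt ε)⁻¹ * Real.sqrt Φ + ψ₀ * Φ := by
  obtain ⟨P₀, hP₀⟩ : ∃ P₀ : ℝ, P₀ = 2 * c₀' * β * n ^ 2 := ⟨_, rfl⟩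
  obtain ⟨P₁, hP₁⟩ : ∃ P₁ : ℝ, P₁ = 2 * α + 2 * c₀' * β * n * (2 * m + 1) := ⟨_, rfl⟩
  obtain ⟨P₂, hP₂⟩ : ∃ P₂ : ℝ, P₂ = m₁ + 2 * c₀' * β * m * (m + 1) := ⟨_, rfl⟩
  obtain ⟨Bc, hBc⟩ : ∃ Bc : ℝ, Bc = 2 * δ'⁻¹ * n := ⟨_, rfl⟩
  have hP₀0 : 0 ≤ P₀ := by rw [hP₀]; positivity
  have hP₁0 : 0 ≤ P₁ := by rw [hP₁]; positivity
  have hP₂0 : 0 ≤ P₂ := by rw [hP₂]; positivity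
  have hBc0 : 0 ≤ Bc := by rw [hBc]; positivity
  refine ⟨P₀ + P₁ * Bc + 2 * P₂ * Bc ^ 2, P₁ * Real.sqrt (2 * a⁻¹), 4 * P₂ * a⁻¹, by positivity,
    by positivity, by positivity, ?_⟩
  intro c₀ b ε X Y Φ hc₀ hc₀le hb hb1 hε hε1 hX0 hY0 hΦ hX hY
  obtain ⟨u, hu⟩ : ∃ u : ℝ, u = Real.sqrt (2 * (a * ε)⁻¹) * Real.sqrt Φ := ⟨_, rfl⟩
  obtain ⟨w, hw⟩ : ∃ w : ℝ, w = u + Bc := ⟨_, rfl⟩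
  have hu0 : 0 ≤ u := by rw [hu]; positivity
  have hw0 : 0 ≤ w := by rw [hw]; positivity
  have hXw : X ≤ w := by rw [hw, hu, hBc]; exact hX
  have hYw : Y ≤ w := by rw [hw, hu, hBc]; exact hY
  -- Stage A: `≤ P₀ + P₁ w + P₂ ε w²`
  have p1 : α * (X + Y) ≤ 2 * α * w := by
    have := mul_le_mul_of_nonneg_left (add_le_add hXw hYw) hα
    linarith only [this]
  have p2 : ε * m₁ * Y * X ≤ m₁ * (ε * w ^ 2) := by
    have : Y * X ≤ w * w := mul_le_mul hYw hXw hX0 hw0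
    calc ε * m₁ * Y * X = ε * m₁ * (Y * X) := by ring
      _ ≤ ε * m₁ * (w * w) := by gcongr
      _ = m₁ * (ε * w ^ 2) := by ring
  have poly := mourre_bookkeeping_poly hn hm hw0 hε.le hε1 hb1
  have hεmb0 : 0 ≤ ε * m + b := by positivity
  have p3 : β * (n + ε * m * Y) * (n + (ε * m + b) * X) ≤
      β * (n ^ 2 + n * (2 * m + 1) * w + m * (m + 1) * (ε * w ^ 2)) := by
    have h1 : (n + ε * m * Y) * (n + (ε * m + b) * X) ≤ (n + ε * m * w) * (n + (ε * m + b) * w) := by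
      gcongr
    calc β * (n + ε * m * Y) * (n + (ε * m + b) * X)
        = β * ((n + ε * m * Y) * (n + (ε * m + b) * X)) := by ring
      _ ≤ _ := mul_le_mul_of_nonneg_left (h1.trans poly) hβ
  have p4 : β * (n + (ε * m + b) * Y) * (n + ε * m * X) ≤
      β * (n ^ 2 + n * (2 * m + 1) * w + m * (m + 1) * (ε * w ^ 2)) := by
    have h1 : (n + (ε * m + b) * Y) * (n + ε * m * X) ≤ (n + (ε * m + b) * w) * (n + ε * m * w) := by
      gcongr
    have h2 : (n + (ε * m + b) * w) * (n + ε * m * w) = (n + ε * m * w) * (n + (ε * m + b) * w) :=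
      mul_comm _ _
    calc β * (n + (ε * m + b) * Y) * (n + ε * m * X)
        = β * ((n + (ε * m + b) * Y) * (n + ε * m * X)) := by ring
      _ ≤ _ := mul_le_mul_of_nonneg_left ((h1.trans h2.le).trans poly) hβ
  have p34 : c₀ * (β * (n + ε * m * Y) * (n + (ε * m + b) * X) +
      β * (n + (ε * m + b) * Y) * (n + ε * m * X)) ≤
      c₀' * (2 * (β * (n ^ 2 + n * (2 * m + 1) * w + m * (m + 1) * (ε * w ^ 2)))) := by
    exact mul_le_mul hc₀le (by linarith only [p3, p4]) (by positivity) hc₀'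
  have stageA : α * (X + Y) + ε * m₁ * Y * X +
      c₀ * (β * (n + ε * m * Y) * (n + (ε * m + b) * X) +
        β * (n + (ε * m + b) * Y) * (n + ε * m * X)) ≤ P₀ + P₁ * w + P₂ * (ε * w ^ 2) := by
    rw [hP₀, hP₁, hP₂]
    linarith only [p1, p2, p34]
  -- Stage B: `w = u + Bc`, `ε u² = (2/a) Φ`, `ε ≤ 1`
  have hsq : Real.sqrt (2 * (a * ε)⁻¹) = Real.sqrt (2 * a⁻¹) * (Real.sqrt ε)⁻¹ := by
    rw [mul_inv, ← mul_assoc, Real.sqrt_mul (by positivity) ε⁻¹, Real.sqrt_inv]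
  have hu' : u = Real.sqrt (2 * a⁻¹) * (Real.sqrt ε)⁻¹ * Real.sqrt Φ := by rw [hu, hsq]
  have hεu : ε * u ^ 2 = 2 * a⁻¹ * Φ := by
    rw [hu, mul_pow, Real.sq_sqrt (by positivity), Real.sq_sqrt hΦ]
    field_simp
  have hεw : ε * w ^ 2 ≤ 4 * a⁻¹ * Φ + 2 * Bc ^ 2 := by
    have h1 : w ^ 2 ≤ 2 * u ^ 2 + 2 * Bc ^ 2 := by rw [hw]; linarith only [sq_nonneg (u - Bc)]
    have h2 : ε * Bc ^ 2 ≤ Bc ^ 2 := mul_le_of_le_one_left (sq_nonneg _) hε1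
    calc ε * w ^ 2 ≤ ε * (2 * u ^ 2 + 2 * Bc ^ 2) := by gcongr
      _ = 2 * (ε * u ^ 2) + 2 * (ε * Bc ^ 2) := by ring
      _ ≤ 2 * (2 * a⁻¹ * Φ) + 2 * Bc ^ 2 := by rw [hεu]; linarith only [h2]
      _ = _ := by ring
  calc _ ≤ P₀ + P₁ * w + P₂ * (ε * w ^ 2) := stageA
    _ = P₀ + P₁ * Bc + P₁ * Real.sqrt (2 * a⁻¹) * (Real.sqrt ε)⁻¹ * Real.sqrt Φ +
          P₂ * (ε * w ^ 2) := by rw [hw, hu']; ring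
    _ ≤ P₀ + P₁ * Bc + P₁ * Real.sqrt (2 * a⁻¹) * (Real.sqrt ε)⁻¹ * Real.sqrt Φ +
          P₂ * (4 * a⁻¹ * Φ + 2 * Bc ^ 2) := by gcongr
    _ = _ := by ring

/-! ## §4. Headline (registered helper stub) -/

/-- **Gronwall integration of Mourre's differential inequality, headline form** (all binders
explicit; registered helper stub of `stub_mourreThresholdLAP`, S6-PLAN F4): for a dissipative
bounded `M`, `Im z < 0`, `ε₀ > 0`, nonnegative `η₀, c₁, ψ₀`, a bound `‖⟪f, G_{ε₀}(z) f⟫‖ ≤ B` and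
the differential inequality `‖⟪f, G_ε M G_ε f⟫‖ ≤ η₀ + c₁ (√ε)⁻¹ √‖⟪f, G_ε f⟫‖ + ψ₀ ‖⟪f, G_ε f⟫‖`
on `(0, ε₀)` (`G_ε = mourreG U M ε z`), one has for every `ε ∈ (0, ε₀)` the integrable bound
`‖⟪f, G_ε M G_ε f⟫‖ ≤ η₀ + c₁ √C₁ (√ε)⁻¹ + ψ₀ C₁`, `C₁ = 2 (B + ε₀η₀ + (2c₁√ε₀)²) e^{ε₀ψ₀}`.
[cite: AmreinBoutetdeMonvelGeorgescu1996, Thm. 7.3.1 eqs. (7.3.11)–(7.3.12)] -/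
theorem mourreG_gronwall_derivative_bound :
    ∀ (K : Type) [NormedAddCommGroup K] [InnerProductSpace ℂ K] [CompleteSpace K]
      (U : Literature.Analysis.UnboundedOperators.OneParameterUnitaryGroup K) (M : K →L[ℂ] K)
      (f : K) (z : ℂ) (ε₀ η₀ c₁ ψ₀ B : ℝ), (∀ g : K, 0 ≤ (inner ℂ g (M g)).re) → z.im < 0 →
      0 < ε₀ → 0 ≤ η₀ → 0 ≤ c₁ → 0 ≤ ψ₀ →
      ‖inner ℂ f
          (Summit.AtomisticToContinuum.FouriersLaw.Theorems.MourreDissolution.mourreG U M ε₀ z f)‖ ≤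
        B →
      (∀ ε ∈ Set.Ioo 0 ε₀,
        ‖inner ℂ f
            (Summit.AtomisticToContinuum.FouriersLaw.Theorems.MourreDissolution.mourreG U M ε z
              (M (Summit.AtomisticToContinuum.FouriersLaw.Theorems.MourreDissolution.mourreG U M ε z
                f)))‖ ≤
          η₀ + c₁ * (Real.sqrt ε)⁻¹ *
              Real.sqrt ‖inner ℂ f
                (Summit.AtomisticToContinuum.FouriersLaw.Theorems.MourreDissolution.mourreG U M ε z
                  f)‖ +
            ψ₀ * ‖inner ℂ f
              (Summit.AtomisticToContinuum.FouriersLaw.Theorems.MourreDissolution.mourreG U M ε z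
                f)‖) →
      ∀ ε ∈ Set.Ioo 0 ε₀,
        ‖inner ℂ f
            (Summit.AtomisticToContinuum.FouriersLaw.Theorems.MourreDissolution.mourreG U M ε z
              (M (Summit.AtomisticToContinuum.FouriersLaw.Theorems.MourreDissolution.mourreG U M ε z
                f)))‖ ≤
          η₀ + c₁ * Real.sqrt (2 * (B + ε₀ * η₀ + (c₁ * (2 * Real.sqrt ε₀)) ^ 2) *
                Real.exp (ε₀ * ψ₀)) * (Real.sqrt ε)⁻¹ +
            ψ₀ * (2 * (B + ε₀ * η₀ + (c₁ * (2 * Real.sqrt ε₀)) ^ 2) * Real.exp (ε₀ * ψ₀)) := by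
  intro K _ _ _ U M f z ε₀ η₀ c₁ ψ₀ B hM hz hε₀ hη₀ hc₁ hψ₀ hB hDI
  exact norm_inner_mourreG_mul_mul_le_of_differential_inequality hM hz U f hε₀ hη₀ hc₁ hψ₀ hB hDI

end Summit.AtomisticToContinuum.FouriersLaw.Theorems.MourreDissolution
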